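import Summits.FinalStateConjecture.FinalStateConjecture.Theses.HorizonTypeCascade
import Summits.FinalStateConjecture.FinalStateConjecture.Theorems.ZeroEnergyRigidity.Negative.MinkowskiNotKerr

/-!
# `SmoothNoHair` needs its connectedness hypothesis (negative lane of crux stmt-FinalStateConjecture-18558)

Refuter crux-attack at birth (route `HorizonTypeCascade`, crux `SmoothNoHair`, rank 5), 2026-08-17.
Pure theorems (no new definitions, no named fact, no `sorry`).

* `kerrConclusionPointwise_iff_isIsometricToKerrExterior`: the conclusion of `SmoothNoHair` — the
  vendored `StationaryAFBlackHole.IsIsometricToKerrExterior hF hP hres` unfolded pointwise WITHOUT the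
  bookkeeping fact `hres` — is EQUIVALENT to the vendored form for every `hres` (`val_restrict` is
  `rfl`): the unfolding changed nothing, and provers may move freely between the two spellings.
* `smoothNoHair_false_without_connected`: the crux with `IsConnected 𝓑.horizon` DELETED (all other
  binders verbatim) is FALSE — any proof of the crux must use connectedness, indeed NON-EMPTINESS, of
  `𝓔⁺`.  Witness: the Minkowski presentation `minkowskiBH` of the sibling negative lane
  `Theorems/ZeroEnergyRigidity/Negative/` (Minkowski `(ℝ⁴, η, ∂ₜ)` as a `StationaryAFBlackHole`):
  `I⁺`-regular (`isIPlusRegular_minkowskiBH`), Ricci-flat, horizon `∂I⁻(M_ext) ∩ I⁺(M_ext) = ∅` (so the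
  Killing-collar hypothesis holds vacuously), d.o.c. `ℝ⁴` — not a sub-extremal Kerr exterior
  (`not_kerrConclusion_minkowskiBH`: Sbierski's `C⁰`-inextendibility, proved in the tree, against the
  smooth extension `{r > r₊} ⊊ {r > 0}`).  `Kerr.Facts`, the Levi-Civita class and the openness facts
  `hF hP` are discharged by tree theorems, so the witness is unconditional.
* `exists_presentation_without_connected_not_kerr`: the same, as joint satisfiability of the
  remaining hypotheses at a presentation with empty horizon where the conclusion fails.

References: P. T. Chruściel, J. L. Costa, Astérisque 321 (2008), Def. 1.1, Thm. 1.3 (hypotheses);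
J. Sbierski, J. Differential Geom. 108 (2018), Thm. 1.
-/

noncomputable section

set_option linter.dupNamespace false

namespace Summit.FinalStateConjecture.FinalStateConjecture.Theorems.SmoothNoHair.Negative

open Set Function Literature.Geometry.Lorentzian
open scoped Manifold ContDiff Topology
open Summit.FinalStateConjecture.FinalStateConjecture.Theorems.ZeroEnergyRigidity.Negative

/-- **The `hres`-free unfolding is harmless.**  For every `hres`, the pointwise conclusion of
`SmoothNoHair` at `𝓑` (a diffeomorphism `Φ` of the open submanifold `⟨⟨M_ext⟩⟩ = 𝓑.docOpens hF hP`
onto `Kerr.exterior M a`, `|a| < M`, with `g_{M,a}(dΦ v, dΦ w) = g(v, w)`) is equivalent to the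
vendored `IsIsometricToKerrExterior hF hP hres` (the restricted metric at `y` is `g` at `↑y` by
`rfl`; `pullbackBilin_apply`). [folklore] -/
theorem kerrConclusionPointwise_iff_isIsometricToKerrExterior (𝓑 : StationaryAFBlackHole.{0})
    [Kerr.Facts] (hF : 𝓑.metric.isOpen_chronologicalFuture 𝓑.timeOrientation)
    (hP : 𝓑.metric.isOpen_chronologicalPast 𝓑.timeOrientation)
    (hres : PseudoRiemannianMetric.contMDiff_restrict (I := 𝓡 4) (n := (∞ : ℕ∞ω))
      (M := 𝓑.carrier)) :
    (∃ (M a : ℝ) (_ : Literature.Geometry.Lorentzian.Kerr.IsSubextremal M a) (Φ : Diffeomorph (𝓡 4) 𝓘(ℝ, Literature.Geometry.Lorentzian.E4) (𝓑.docOpens hF hP) (Literature.Geometry.Lorentzian.Kerr.exterior M a) ((⊤ : ℕ∞) : WithTop ℕ∞)), ∀ (y : 𝓑.docOpens hF hP) (v w : EuclideanSpace ℝ (Fin 4)), (Literature.Geometry.Lorentzian.Kerr.smoothMetric M a (Literature.Geometry.Lorentzian.Kerr.rPlus M a)).val (Φ y) (mfderiv (𝓡 4) 𝓘(ℝ, Literature.Geometry.Lorentzian.E4)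 Φ y v) (mfderiv (𝓡 4) 𝓘(ℝ, Literature.Geometry.Lorentzian.E4) Φ y w) = 𝓑.metric.val y.1 v w) ↔
      𝓑.IsIsometricToKerrExterior hF hP hres := by
  constructor
  · rintro ⟨M, a, hMa, Φ, hΦ⟩
    refine ⟨M, a, hMa, Φ, fun y ↦ ?_⟩
    ext v w
    rw [pullbackBilin_apply]
    exact hΦ y v w
  · rintro ⟨M, a, hMa, Φ, hΦ⟩
    refine ⟨M, a, hMa, Φ, fun y v w ↦ ?_⟩
    have h := congrArg (fun B ↦ B v w) (hΦ y)
    rw [pullbackBilin_apply] at h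
    exact h

/-- **Any proof of `SmoothNoHair` must use `IsConnected 𝓑.horizon`** (indeed `𝓔⁺ ≠ ∅`): the crux
`HorizonTypeCascade.SmoothNoHair` (stmt-FinalStateConjecture-18558) with that hypothesis DELETED —
all other binders and the conclusion verbatim — is FALSE.  Witness `minkowskiBH` (Minkowski
`(ℝ⁴, η, ∂ₜ)` presented as a `StationaryAFBlackHole`): `I⁺`-regular, Ricci-flat, horizon
`∂I⁻(M_ext) ∩ I⁺(M_ext) = ∅` — so the Killing-collar hypothesis is vacuous — while its d.o.c. `ℝ⁴`
is `C⁰`-inextendible (Sbierski) and every sub-extremal Kerr exterior extends smoothly into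
`{r > 0}`. [cite: SbierskiJDG2018, Thm. 1] -/
theorem smoothNoHair_false_without_connected :
    ¬ ∀ (𝓑 : Literature.Geometry.Lorentzian.StationaryAFBlackHole.{0}) [𝓑.metric.HasLeviCivita] [Literature.Geometry.Lorentzian.Kerr.Facts] (hF : 𝓑.metric.isOpen_chronologicalFuture 𝓑.timeOrientation) (hP : 𝓑.metric.isOpen_chronologicalPast 𝓑.timeOrientation), 𝓑.IsIPlusRegular → 𝓑.metric.toPseudoRiemannianMetric.IsRicciFlat → (∀ p ∈ 𝓑.horizon, ∃ (U : Set 𝓑.carrier) (K : Π x : 𝓑.carrier, TangentSpace (𝓡 4) x) (κ : ℝ), IsOpen U ∧ connectedComponentIn 𝓑.horizon p ⊆ U ∧ ContMDiffOn (𝓡 4) ((𝓡 4).prod 𝓘(ℝ, Literature.Geometry.Lorentzian.E4)) ((⊤ : ℕ∞) : WithTop ℕ∞) (fun x ↦ (Bundle.TotalSpace.mk' Literature.Geometry.Lorentzian.E4 x (K x) : TangentBundle (𝓡 4) 𝓑.carrier)) U ∧ (∀ x ∈ U, ∀ v w : TangentSpace (𝓡 4) x, 𝓑.metric.val x (𝓑.metric.leviCivita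 K x v) w + 𝓑.metric.val x v (𝓑.metric.leviCivita K x w) = 0) ∧ (∀ x ∈ U, VectorField.mlieBracket (𝓡 4) 𝓑.killing K x = 0) ∧ (∀ q ∈ connectedComponentIn 𝓑.horizon p, K q ≠ 0) ∧ (∀ γ : ℝ → 𝓑.carrier, IsMIntegralCurve γ K → γ 0 ∈ connectedComponentIn 𝓑.horizon p → ∀ t, γ t ∈ 𝓑.horizon) ∧ κ ≠ 0 ∧ ∀ q ∈ connectedComponentIn 𝓑.horizon p, 𝓑.metric.leviCivita K q (K q) = κ • K q) → (∃ (M a : ℝ) (_ : Literature.Geometry.Lorentzian.Kerr.IsSubextremal M a) (Φ : Diffeomorph (𝓡 4) 𝓘(ℝ, Literature.Geometry.Lorentzian.E4) (𝓑.docOpens hF hP) (Literature.Geometry.Lorentzian.Kerr.exterior M a) ((⊤ : ℕ∞) : WithTop ℕ∞)), ∀ (y : 𝓑.docOpens hF hP) (v w : EuclideanSpace ℝ (Fin 4)), (Literature.Geometry.Lorentzian.Kerr.smoothMetric M a (Literature.Geometry.Lorentzian.Kerr.rPlus M a)).val (Φ y) (mfderiv (𝓡 4) 𝓘(ℝ,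 Literature.Geometry.Lorentzian.E4) Φ y v) (mfderiv (𝓡 4) 𝓘(ℝ, Literature.Geometry.Lorentzian.E4) Φ y w) = 𝓑.metric.val y.1 v w) := by
  intro h
  haveI : Kerr.Facts := kerrFacts
  haveI : minkowskiBH.metric.HasLeviCivita :=
    minkowskiBH.metric.toPseudoRiemannianMetric.hasLeviCivita
  have hK := h minkowskiBH LorentzianMetric.isOpen_chronologicalFuture_holds_of_boundaryless
    LorentzianMetric.isOpen_chronologicalPast_holds_of_boundaryless isIPlusRegular_minkowskiBH
    h1_minkowskiBH
    (fun p hp ↦ absurd (horizon_minkowskiBH ▸ hp : p ∈ (∅ : Set E4)) (Set.notMem_empty p))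
  exact not_kerrConclusion_minkowskiBH
    (kerrConclusion_of_isIsometricToKerrExterior minkowskiBH _ _
      PseudoRiemannianMetric.contMDiff_restrict_holds
      ((kerrConclusionPointwise_iff_isIsometricToKerrExterior minkowskiBH _ _ _).1 hK))

/-- Equivalently: the hypotheses of `SmoothNoHair` other than connectedness of `𝓔⁺` are JOINTLY
SATISFIABLE by a presentation with EMPTY horizon at which the (pointwise) Kerr conclusion fails —
so a restate admitting `𝓔⁺ = ∅` must weaken the conclusion to "Kerr or Minkowski". [folklore] -/
theorem exists_presentation_without_connected_not_kerr :
    ∃ (𝓑 : StationaryAFBlackHole.{0}) (_ : 𝓑.metric.HasLeviCivita) (_ : Kerr.Facts)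
      (hF : 𝓑.metric.isOpen_chronologicalFuture 𝓑.timeOrientation)
      (hP : 𝓑.metric.isOpen_chronologicalPast 𝓑.timeOrientation),
      𝓑.horizon = ∅ ∧ 𝓑.IsIPlusRegular ∧ 𝓑.metric.toPseudoRiemannianMetric.IsRicciFlat ∧
      ¬ (∃ (M a : ℝ) (_ : Literature.Geometry.Lorentzian.Kerr.IsSubextremal M a) (Φ : Diffeomorph (𝓡 4) 𝓘(ℝ, Literature.Geometry.Lorentzian.E4) (𝓑.docOpens hF hP) (Literature.Geometry.Lorentzian.Kerr.exterior M a) ((⊤ : ℕ∞) : WithTop ℕ∞)), ∀ (y : 𝓑.docOpens hF hP) (v w : EuclideanSpace ℝ (Fin 4)), (Literature.Geometry.Lorentzian.Kerr.smoothMetric M a (Literature.Geometry.Lorentzian.Kerr.rPlus M a)).val (Φ y) (mfderiv (𝓡 4) 𝓘(ℝ, Literature.Geometry.Lorentzian.E4) Φ y v) (mfderiv (𝓡 4) 𝓘(ℝ, Literature.Geometry.Lorentzian.E4) Φ y w) = 𝓑.metric.val y.1 v w) := by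
  haveI hKF : Kerr.Facts := kerrFacts
  haveI hL : minkowskiBH.metric.HasLeviCivita :=
    minkowskiBH.metric.toPseudoRiemannianMetric.hasLeviCivita
  refine ⟨minkowskiBH, hL, hKF, LorentzianMetric.isOpen_chronologicalFuture_holds_of_boundaryless,
    LorentzianMetric.isOpen_chronologicalPast_holds_of_boundaryless, horizon_minkowskiBH,
    isIPlusRegular_minkowskiBH, h1_minkowskiBH, fun hK ↦ ?_⟩
  exact not_kerrConclusion_minkowskiBH
    (kerrConclusion_of_isIsometricToKerrExterior minkowskiBH _ _
      PseudoRiemannianMetric.contMDiff_restrict_holds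
      ((kerrConclusionPointwise_iff_isIsometricToKerrExterior minkowskiBH _ _ _).1 hK))

end Summit.FinalStateConjecture.FinalStateConjecture.Theorems.SmoothNoHair.Negative

end
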